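import Literature.NumberTheory.GaloisRepresentations.IdeleProjectionAssembly
import Literature.NumberTheory.GaloisRepresentations.HomDualReadoutRestrict
import Literature.NumberTheory.GaloisRepresentations.UnramifiedKummer
import Literature.NumberTheory.EllipticCurves.PeriodIndexSupport
import HarnessLib

/-!
# Readouts of `J̄`-valued morphisms off a finite set of places: UNIT values (`J_E = ⋃_S J_{E,S}`) and
# INTEGRAL valuations at the places unramified in the trivialising layer (values in `K_v^{nr}`)

Topic `NumberTheory/GaloisRepresentations`; namespace `Literature.NumberTheory.GaloisRepresentations.IdeleReadout`.
Theorems only (no definition, no named fact, no instance, no notation, no `sorry`); number fields in `Type`.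
Sequel of door-c5 g17's `IdeleProjection` / `IdeleProjectionAssembly` (THE idèle projections
`π_v = ideleProjection K v : J̄ → K̄_vˣ`, the readout maps `readoutMap π X f = π_v ∘ f`) and of door-c6's
`HomDualReadoutRestrict` (the inertia bridge `isUnramifiedAt_iff_toLocal_holds`) and `SpectralOrdQ`
(`ordQ : K̄_vˣ → ℚ`, integral on `K_v^{nr}`).

THE MATHEMATICS (the two finiteness inputs of the unit refinement in Milne's proof of *ADT* I Lemma 4.13,
for an object `X` of door-c4's `C_Γ = DiscreteRepCat ℤ Γ_K` of finite type on which a layer `U_E = Gal(K̄/E)`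
acts trivially).
* §1 **Almost every place is unramified for `X`**: the finite places `v` with `X` (as a discrete Galois module
  `toDGM X`) NOT unramified at `v` form a finite set (`finite_setOf_not_isUnramifiedAt_toDGM`) — the inertia groups
  above `v` lie in the open subgroup `U_E` for all but finitely many `v` (tree:
  `EllipticCurves.eventually_forall_inertia_le`, Neukirch III (2.6)).
* §2 **At an unramified place every `Γ_{K_v}`-equivariant `e : X → K̄_vˣ` takes values in `K_v^{nr}`**
  (`unitsVal_mem_maxUnramified_of_isUnramifiedAt`): the local inertia group `I_{K_v} = Gal(K̄_v/K_v^{nr})` acts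
  trivially on `X|_v` (inertia bridge), so it fixes `e(x) = e(σ x) = σ · e(x)`; infinite Galois theory
  (`K_v^{nr}` is the fixed field of `I_{K_v}`).  Hence **`ord (e x) ∈ ℤ`** (`exists_int_cast_eq_ordQ_of_isUnramifiedAt`).
* §3 **The readouts `π_v ∘ g` of a morphism `g : X ⟶ J̄` are unit-valued off a finite set of places**
  (`exists_finset_forall_ordQ_readoutMap_eq_zero`): the layer lift `g_E : X → J_E` of `g` takes the finitely many
  generators of `X` into some `J_{E,T₀}` (`J_E = ⋃_S J_{E,S}`, `IdeleCohomology.exists_mem_ideleS`), hence all of `X`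
  (a subgroup), and `‖π_v z‖ = 1` for `z ∈ J_{E,T₀}`, `v ∉ T₀` (`algNorm_idelePlaceReadout_eq_one_of_mem_ideleS`).

USE: these are the hypotheses `hint` (integrality) and `hunit` of this seat's unit correction
`HomDual.exists_unitValued_extension` and of door-c5 g17's assembly `exists_hom_readoutInvariant_eq` in the
local-to-global extension principle for `J̄`-valued morphisms (`IdeleExtensionLocalGlobal`, input (B) of
property (e) of the `Ш²`-readout road to `poitouTate_sha_tateDual`).
HONEST FRAMING: no case of Poitou–Tate or BSD is proved here.

## References
* J. S. Milne, *Arithmetic Duality Theorems* (2nd ed. 2006), I Lemma 4.13 (proof). [MilneADT2006]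
* J. Neukirch, *Algebraic Number Theory* (1999), Ch. II (9.6), Ch. III Thm. (2.6). [NeukirchANT1999]
* J.-P. Serre, *Local Fields*, GTM 67 (1979), IV §4 (`K^{nr}` and the inertia group). [SerreLocalFields1979]
-/

noncomputable section

open NumberField NumberField.InfinitePlace IsDedekindDomain Field CategoryTheory
open Literature.NumberTheory.Automorphic

namespace Literature.NumberTheory.GaloisRepresentations

namespace IdeleReadout

open SemiLocal ArchHerbrand DiscreteGaloisModule IdeleCohomology IdeleClassBar HomDual DGMBridge
  IsNonarchimedeanLocalField Literature.Algebra.Homology Literature.Algebra.Homology.DiscreteRep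
  Literature.AnabelianGeometry.AbsoluteAnabelian

variable {K : Type} [Field K] [NumberField K] (E : GalLayer K)
variable (X : DiscreteRepCat ℤ (absoluteGaloisGroup K))
  (hX : ∀ σ ∈ E.openNormalSubgroup, ∀ x : X.obj.V, X.obj.ρ σ x = x)

/-! ## §1 A layer-trivialised object is unramified at almost every place -/

omit [NumberField K] in
include hX in
/-- If every inertia group above `v` lies in `U_E`, the `U_E`-trivial `X` is unramified at `v`.
[cite: NeukirchANT1999, Ch. III Thm. (2.6)] -/
theorem isUnramifiedAt_toDGM_of_forall_inertia_le [NumberField K] (v : HeightOneSpectrum (𝓞 K))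
    (hv : ∀ 𝔓 ∈ v.primesAbove, 𝔓.inertia (absoluteGaloisGroup K) ≤ (E.openNormalSubgroup : Subgroup (absoluteGaloisGroup K))) :
    GaloisRep.IsUnramifiedAt v (toDGM X) := by
  intro 𝔓 h𝔓 σ hσ
  refine LinearMap.ext fun x => ?_
  change toDGM X σ x = x
  rw [toDGM_apply, hX σ (hv 𝔓 h𝔓 hσ)]
  rfl

include hX in
/-- **The set of finite places at which a `U_E`-trivial `X` is NOT unramified is finite** (ramification of
`E/K` is supported on finitely many places). [cite: NeukirchANT1999, Ch. III Thm. (2.6)] [cite: MilneADT2006, I Lemma 4.13 (proof)] -/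
theorem finite_setOf_not_isUnramifiedAt_toDGM :
    {v : HeightOneSpectrum (𝓞 K) | ¬ GaloisRep.IsUnramifiedAt v (toDGM X)}.Finite := by
  have hev := Literature.NumberTheory.EllipticCurves.eventually_forall_inertia_le (F := K)
    (E.openNormalSubgroup : Subgroup (absoluteGaloisGroup K)) (LayerColimit.coe_isOpen E.openNormalSubgroup)
  rw [Filter.eventually_cofinite] at hev
  exact hev.subset fun v hv h => hv (isUnramifiedAt_toDGM_of_forall_inertia_le E X hX v h)

include hX in
/-- Finset form: a finite set `T₁` of finite places off which `X` is unramified. [cite: NeukirchANT1999, Ch. III Thm. (2.6)] -/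
theorem exists_finset_forall_isUnramifiedAt_toDGM :
    ∃ T₁ : Finset (HeightOneSpectrum (𝓞 K)), ∀ v ∉ T₁, GaloisRep.IsUnramifiedAt v (toDGM X) :=
  ⟨(finite_setOf_not_isUnramifiedAt_toDGM E X hX).toFinset, fun v hv => by
    by_contra h
    exact hv ((Set.Finite.mem_toFinset _).2 h)⟩

/-! ## §2 At an unramified place, equivariant maps `X → K̄_vˣ` are `K_v^{nr}`-valued, of integral valuation -/

section Unramified

variable {X}
variable [Module.Finite ℤ (LCarrier X)] (v : HeightOneSpectrum (𝓞 K))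

/-- **Values of a `Γ_{K_v}`-equivariant `e : X → K̄_vˣ` lie in `K_v^{nr}` when `X` is unramified at `v`**: the local
inertia group acts trivially on `X|_v` (`isUnramifiedAt_iff_toLocal_holds`), hence fixes every value of `e`, and
`K_v^{nr}` is the fixed field of the inertia group (`mem_absInertia_iff_forall_mem_maxUnramified`, infinite Galois
theory). [cite: SerreLocalFields1979, IV §4] [cite: NeukirchANT1999, Ch. II (9.6)] -/
theorem unitsVal_mem_maxUnramified_of_isUnramifiedAt (hur : GaloisRep.IsUnramifiedAt v (toDGM X))
    (e : (homGaloisModule ((toDGM X).restrictField (v.adicCompletion K)) (units (v.adicCompletion K))).toTopRep.ρ.invariants)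
    (x : LCarrier X) :
    ((unitsVal (v.adicCompletion K) ((show LCarrier X →ₗ[ℤ] UnitsCarrier (v.adicCompletion K) from
        (e.1 : DiscreteRep.HomCarrier (LCarrier X) (UnitsCarrier (v.adicCompletion K)))) x) :
          (AlgebraicClosure (v.adicCompletion K))ˣ) : AlgebraicClosure (v.adicCompletion K)) ∈
      maxUnramified (v.adicCompletion K) := by
  haveI : CharZero (v.adicCompletion K) := charZero_of_algebra (K := K) (v.adicCompletion K)
  haveI : IsGalois (v.adicCompletion K) (AlgebraicClosure (v.adicCompletion K)) := IsGalois.mk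
  set y : AlgebraicClosure (v.adicCompletion K) :=
    ((unitsVal (v.adicCompletion K) ((show LCarrier X →ₗ[ℤ] UnitsCarrier (v.adicCompletion K) from
        (e.1 : DiscreteRep.HomCarrier (LCarrier X) (UnitsCarrier (v.adicCompletion K)))) x) :
          (AlgebraicClosure (v.adicCompletion K))ˣ) : AlgebraicClosure (v.adicCompletion K)) with hy
  -- every `σ` in the inertia group fixes `y`
  have hfix : ∀ σ ∈ absInertia (v.adicCompletion K), σ • y = y := fun σ hσ => by
    have h1 := (GaloisRep.isUnramifiedAt_iff_toLocal_holds v (toDGM X)).1 hur σ hσ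
    have hx : ((toDGM X).restrictField (v.adicCompletion K)) σ x = x := by
      have h2 := LinearMap.congr_fun h1 x
      rw [Module.End.one_apply] at h2
      exact h2
    have hinv := (mem_invariants_iff ((toDGM X).restrictField (v.adicCompletion K)) (units (v.adicCompletion K)) e.1).1
      e.2 σ x
    rw [hx] at hinv
    have hval := congrArg (fun u : UnitsCarrier (v.adicCompletion K) =>
      ((unitsVal (v.adicCompletion K) u : (AlgebraicClosure (v.adicCompletion K))ˣ) : AlgebraicClosure (v.adicCompletion K)))
      hinv
    simp only [unitsVal_apply, Units.coe_smul] at hval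
    rw [hy]
    exact hval.symm
  -- and `K_v^{nr}` is the fixed field of the inertia group
  rw [← InfiniteGalois.fixedField_fixingSubgroup (maxUnramified (v.adicCompletion K)), IntermediateField.mem_fixedField_iff]
  intro τ hτ
  refine hfix τ ((mem_absInertia_iff_forall_mem_maxUnramified (F := v.adicCompletion K)).2 fun z hz => ?_)
  exact (IntermediateField.mem_fixingSubgroup_iff _ _).1 hτ z hz

/-- **`ord (e x) ∈ ℤ` at an unramified place** (valuations are integral on `K_v^{nr}`, `SpectralOrdQ`): the integrality
input `hint` of `HomDual.exists_unitValued_extension`. [cite: SerreLocalFields1979, III §5 Thm. 2, IV §4] -/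
theorem exists_int_cast_eq_ordQ_of_isUnramifiedAt (hur : GaloisRep.IsUnramifiedAt v (toDGM X))
    (e : (homGaloisModule ((toDGM X).restrictField (v.adicCompletion K)) (units (v.adicCompletion K))).toTopRep.ρ.invariants)
    (x : LCarrier X) :
    ∃ m : ℤ, (m : ℚ) = ordQ (v.adicCompletion K) ((show LCarrier X →ₗ[ℤ] UnitsCarrier (v.adicCompletion K) from
        (e.1 : DiscreteRep.HomCarrier (LCarrier X) (UnitsCarrier (v.adicCompletion K)))) x) :=
  exists_int_cast_eq_ordQ (v.adicCompletion K) (unitsVal_mem_maxUnramified_of_isUnramifiedAt v hur e x)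

end Unramified

/-! ## §3 The readouts of a morphism `X ⟶ J̄` are unit-valued off a finite set of places -/

section UnitValued

variable {X}

include hX in
/-- **The layer lift of `g : X ⟶ J̄` takes values in a single `J_{E,T₀}`** (`X` finitely generated, `J_E = ⋃_S J_{E,S}`).
[cite: CasselsFrohlichANT1967, Ch. VII §7.3] [cite: MilneADT2006, I Lemma 4.13 (proof)] -/
theorem exists_finset_forall_layerLift_mem_ideleS [Module.Finite ℤ (LCarrier X)] (g : X ⟶ ideleBarD K) :
    ∃ T₀ : Finset (HeightOneSpectrum (𝓞 K)), ∀ x : X.obj.V,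
      (haveI := E.numberField;
        (Additive.toMul ((ideleData K).layerLift E hX g x) : ideleGroup E.1) ∈ ideleS K E.1 T₀) := by
  classical
  haveI := E.numberField
  -- a finite generating set of `X` and, for each element, an `S` with value in `J_{E,S}`
  obtain ⟨s, hs⟩ := Module.Finite.fg_top (R := ℤ) (M := LCarrier X)
  let F : LCarrier X →+ Additive (ideleGroup E.1) := ((ideleData K).layerLift E hX g).comp (LCarrier.val X)
  choose Sx hSx using fun x : LCarrier X => exists_mem_ideleS (F := K) (Additive.toMul (F x))
  refine ⟨s.sup Sx, fun x => ?_⟩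
  -- the elements mapping into `J_{E,T₀}` form a subgroup containing the generators
  let A : AddSubgroup (LCarrier X) := ((ideleS K E.1 (s.sup Sx)).toAddSubgroup).comap F
  have hle : Submodule.span ℤ (s : Set (LCarrier X)) ≤ A.toIntSubmodule := by
    rw [Submodule.span_le]
    intro y hy
    change Additive.toMul (F y) ∈ ideleS K E.1 (s.sup Sx)
    exact ideleS_mono (Finset.le_sup (f := Sx) hy) (hSx y)
  have hmem : LCarrier.of X x ∈ A.toIntSubmodule := hle (by rw [hs]; exact Submodule.mem_top)
  exact hmem

include hX in
/-- **The readouts `π_v ∘ g` of `g : X ⟶ J̄` are unit-valued at every finite place outside a finite set `T₀`**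
(`ord (π_v (g x)) = 0`): the hypothesis `hunit` of door-c5 g17's assembly for the family `(π_v ∘ g)_v`.
[cite: MilneADT2006, I Lemma 4.13 (proof)] [cite: CasselsFrohlichANT1967, Ch. VII §7.3] -/
theorem exists_finset_forall_ordQ_readoutMap_eq_zero [Module.Finite ℤ (LCarrier X)] (g : X ⟶ ideleBarD K) :
    ∃ T₀ : Finset (HeightOneSpectrum (𝓞 K)), ∀ v ∉ T₀, ∀ x : LCarrier X,
      ordQ (v.adicCompletion K) (readoutMap (ideleProjection K (Sum.inr v)) X g x) = 0 := by
  haveI := E.numberField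
  haveI := E.isGalois
  obtain ⟨T₀, hT₀⟩ := exists_finset_forall_layerLift_mem_ideleS E hX g
  refine ⟨T₀, fun v hv x => ?_⟩
  rw [ordQ_eq_zero_iff, readoutMap_apply, ideleProjection_inr_layerLift v E hX g]
  have h := algNorm_idelePlaceReadout_eq_one_of_mem_ideleS v (layerEmb E) (hT₀ (LCarrier.val X x)) hv
  rwa [ofMul_toMul] at h

end UnitValued

end IdeleReadout

end Literature.NumberTheory.GaloisRepresentations

end
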